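import Summits.CriticalPhenomena.CardyFormulaZ2.Theorems.CardyBoundaryCoulombGasHalfPlaneMarkDensityLawOneArmCardyAsymptotics
import Summits.CriticalPhenomena.CardyFormulaZ2.Theorems.CardyBoundaryCoulombGasHalfPlaneMarkDensityLawExponentOfBlocks
import Summits.CriticalPhenomena.CardyFormulaZ2.Theorems.CardyBoundaryCoulombGasHalfPlaneMarkDensityLawBlockAnti
import Summits.CriticalPhenomena.CardyFormulaZ2.Theorems.CardyBoundaryCoulombGasHalfPlaneMarkDensityLawLowerBlock
import Summits.CriticalPhenomena.CardyFormulaZ2.Theorems.CardyBoundaryCoulombGasHalfPlaneMarkDensityLawUpperBlock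
import Summits.CriticalPhenomena.CardyFormulaZ2.Theorems.CardyBoundaryCoulombGasHalfPlaneMarkDensityLawIntegerMarks
import Summits.CriticalPhenomena.CardyFormulaZ2.Theorems.CardyBoundaryCoulombGasHalfPlaneMarkDensityLawNecessity
import Summits.CriticalPhenomena.CardyFormulaZ2.Theorems.HalfPlaneMarkDensityLaw.Negative.CardyContent
import Summits.CriticalPhenomena.CardyFormulaZ2.Theorems.HalfPlaneOneArmThird.Negative.Basics
import Literature.Probability.Percolation.HalfPlaneOneArmQuasiMultiplicativity
import Literature.Probability.Percolation.HalfPlaneArmAxisInputs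
import HarnessLib

/-!
# Line `Sketch` — crux 5 ⟹ crux 6: the half-plane mark density law implies the half-plane
# one-arm exponent `1/3` of bond-`ℤ²` (crux stmt-CriticalPhenomena-5661 ⟹ stmt-CriticalPhenomena-5662)

`halfPlaneOneArmThird_of_halfPlaneMarkDensityLaw : HalfPlaneMarkDensityLaw → HalfPlaneOneArmThird`
(route `CardyBoundaryCoulombGas` of `CardyFormulaZ2`): the `j = 1` half-plane case of the
Smirnov–Werner derivation of arm exponents from Cardy's formula, on bond-`ℤ²` at `p = 1/2`, with
the collinear half-plane Cardy law for INTEGER marks (`stub_integerMarks`, equivalent to the crux)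
as the only conformal input:

* `θ(n) = P_{1/2}[0 ↔ ∂([-n,n]×[0,n]) in the half-box]` is the half-plane one-arm probability of
  the abstract layer (`HalfPlaneArm.axisArm_eq`); it is positive, `≤ 1` and antitone
  (`HalfPlaneArm.real_arm_anti`);
* UPPER blocks (`upperBlocks`): `θ(4KN) ≤ θ(N) · P(E₀[N+2, 4KN-1])` (`HalfPlaneArm.real_arm_le_mul`,
  independence) `≤ θ(N) · P(E₀[2N, 2KN])` (`stub_blockAnti`) `≤ θ(N) · c⁻¹ · P[[2N,4N]×{0} ↔ [KN,2KN]×{0}]`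
  (`stub_upperBlock`, two U's and Harris–FKG) and the last probability tends to `F(η(2,4,K,2K))`
  (Cardy), whose logarithm is `-(1/3) log (4K) + O(1)` (`stub_upperSlope`);
* LOWER blocks (`lowerBlocks`): `θ(16Kn) ≥ c · θ(4n) · P(E₀[n, 16Kn+1])` (`HalfPlaneArm.real_arm_ge_mul`,
  gluing through a U) `≥ c · θ(4n) · P[[0,n]×{0} ↔ [(16K+1)n, 32Kn]×{0}]` (`stub_lowerBlock`) and the
  last probability tends to `F(η(0,1,16K+1,32K))`, logarithm `-(1/3) log (4K) + O(1)` (`stub_lowerSlope`);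
* the model-free `stub_exponentOfBlocks` turns the two-sided geometric blocks at every `Λ = 4K` into
  `log θ(n) / log n → -1/3`.
-/

noncomputable section

namespace Summit.CriticalPhenomena.CardyFormulaZ2.Cruxes.HalfPlaneMarkDensityLaw.SketchLine

open Literature.Probability.Percolation Literature.Probability.LatticeModels
open Literature.Probability.RandomPlanarGeometry (crossRatio)
open MeasureTheory Filter Set
open scoped Topology
open Summit.CriticalPhenomena.CardyFormulaZ2.Theses.CardyBoundaryCoulombGas
  (HalfPlaneMarkDensityLaw HalfPlaneOneArmThird RectilinearCardy)
open Summit.CriticalPhenomena.CardyFormulaZ2.Theorems.HalfPlaneMarkDensityLaw.Negative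
open Summit.CriticalPhenomena.CardyFormulaZ2.Theorems.HalfPlaneOneArmThird.Negative
  (prob prob_pos armEvt halfBox ExponentAt crux_iff crux_shared)

namespace OneArm

/-- Cardy's function `F` (the `RandomPlanarGeometry` copy). -/
local notation3 "𝔽" => Literature.Probability.RandomPlanarGeometry.cardyFunction

local notation3 "ν⁰[" v "]" =>
  max |(v : Site 2) 0 - (0 : Site 2) 0| ((v : Site 2) 1 - (0 : Site 2) 1)
local notation3 "ann₀[" r ", " R "]" => {v : Site 2 | 0 ≤ v 1 ∧ r ≤ ν⁰[v] ∧ ν⁰[v] ≤ R}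
local notation3 "E₀[" r ", " R "]" =>
  openCrossing ann₀[r, R] {v : Site 2 | ν⁰[v] = r} {v : Site 2 | ν⁰[v] = R}
local notation3 "arm₀[" n "]" =>
  openCrossing {v : Site 2 | 0 ≤ v 1 ∧ ν⁰[v] ≤ n} {(0 : Site 2)} {v : Site 2 | ν⁰[v] = n}

/-! ## The one-arm probability as the arm event of the abstract layer -/

/-- `θ(n) = P_{1/2}(arm₀[n])`: the crux-6 probability is the half-plane one-arm probability of the
abstract layer at the base point `0` (`HalfPlaneArm.axisArm_eq`). [folklore] -/
theorem prob_half_eq (n : ℕ) : prob half n = μ.real arm₀[(n : ℤ)] := by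
  simp only [prob, armEvt, halfBox, μ]
  rw [HalfPlaneArm.axisArm_eq]

/-- `θ` is antitone (first exit, `HalfPlaneArm.real_arm_anti`). [folklore] -/
theorem prob_half_antitone : Antitone fun n : ℕ ↦ prob half n := by
  intro m n hmn
  simp only [prob_half_eq]
  exact HalfPlaneArm.real_arm_anti (X := fun v : Site 2 => v 0) (Y := fun v : Site 2 => v 1)
    HalfPlaneArm.axis_X_le HalfPlaneArm.axis_Y_le half 0 (by positivity) (by exact_mod_cast hmn)

/-- `0 < θ(n)` at `p = 1/2` (finite energy). [folklore] -/
theorem prob_half_pos (n : ℕ) : 0 < prob half n :=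
  prob_pos (p := half) (by rw [coe_half]; norm_num) n

/-- `θ(n) ≤ 1`. [folklore] -/
theorem prob_half_le_one (n : ℕ) : prob half n ≤ 1 := by
  rw [prob_half_eq]
  exact measureReal_le_one

/-- `k ≤ Λ^k` for `Λ ≥ 2`. [folklore] -/
theorem le_pow_of_two_le {Λ : ℕ} (hΛ : 2 ≤ Λ) (k : ℕ) : k ≤ Λ ^ k :=
  (Nat.lt_pow_self (by omega)).le

/-! ## Upper blocks -/

/-- **Upper geometric blocks from the collinear integer-marks Cardy law.** For every `δ > 0` there
are `Λ = 4K ≥ 2`, `q > 0` with `log q ≤ (-1/3 + δ) log Λ` and `k₀` such that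
`θ(Λ^{k+1}) ≤ q · θ(Λ^k)` for `k ≥ k₀`. [cite: SmirnovWernerMRL2001, Thm. 3 (j = 1), §4] -/
theorem upperBlocks
    (hC : ∀ A B C Y : ℤ, A < B → B < C → C < Y →
      Tendsto (fun N : ℕ ↦ μ.real (openCrossing halfPlane (rowIcc (A * N) (B * N)) (rowIcc (C * N) (Y * N))))
        atTop (𝓝 (𝔽 (crossRatio ![(A : ℝ), B, C, Y])))) :
    ∀ δ : ℝ, 0 < δ → ∃ Λ : ℕ, 2 ≤ Λ ∧ ∃ q : ℝ, 0 < q ∧ Real.log q ≤ (-(1 / 3 : ℝ) + δ) * Real.log Λ ∧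
      ∃ k₀ : ℕ, ∀ k : ℕ, k₀ ≤ k → prob half (Λ ^ (k + 1)) ≤ q * prob half (Λ ^ k) := by
  intro δ hδ
  obtain ⟨c, hc, m₀, hUB⟩ := stub_upperBlock
  -- choose the modulus `K`
  have hslope := stub_upperSlope (2 / c) (by positivity)
  have hev : ∀ᶠ K : ℕ in atTop, Real.log (2 / c * 𝔽 (crossRatio ![(2 : ℝ), 4, K, 2 * K])) /
      Real.log ((4 * K : ℕ) : ℝ) < -(1 / 3 : ℝ) + δ :=
    hslope.eventually (eventually_lt_nhds (by linarith))
  obtain ⟨K, hKslope, hK5⟩ := (hev.and (eventually_ge_atTop 5)).exists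
  set η : ℝ := crossRatio ![(2 : ℝ), 4, K, 2 * K] with hη_def
  have hK5' : (5 : ℝ) ≤ K := by exact_mod_cast hK5
  have hη : η ∈ Ioo (0 : ℝ) 1 := crossRatio_four_mem_Ioo (by norm_num) (by linarith) (by linarith)
  have hF : 0 < 𝔽 η := cardyFunction_pos_of_mem_Ioo hη
  have hlogΛ : 0 < Real.log ((4 * K : ℕ) : ℝ) :=
    Real.log_pos (by exact_mod_cast (show 1 < 4 * K by omega))
  refine ⟨4 * K, by omega, 2 / c * 𝔽 η, by positivity, ?_, ?_⟩
  · exact ((div_lt_iff₀ hlogΛ).1 hKslope).le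
  -- the Cardy input along `N`
  have hT := hC 2 4 K (2 * K) (by norm_num) (by omega) (by omega)
  push_cast at hT
  have hevN : ∀ᶠ N : ℕ in atTop,
      μ.real (openCrossing halfPlane (rowIcc (2 * (N : ℤ)) (4 * N)) (rowIcc ((K : ℤ) * N) (2 * K * N))) ≤
        2 * 𝔽 η :=
    (hT.eventually (eventually_lt_nhds (by linarith : 𝔽 η < 2 * 𝔽 η))).mono
      fun N h ↦ h.le
  obtain ⟨N₀, hN₀⟩ := eventually_atTop.1 (hevN.and (eventually_ge_atTop (max m₀ 2)))
  refine ⟨N₀, fun k hk ↦ ?_⟩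
  -- the scale `N = Λ^k`
  obtain ⟨hPN, hN2⟩ := hN₀ ((4 * K) ^ k) (hk.trans (le_pow_of_two_le (by omega) k))
  set N : ℕ := (4 * K) ^ k with hN_def
  have hNm : m₀ ≤ N := le_trans (le_max_left _ _) hN2
  have hN2' : 2 ≤ N := le_trans (le_max_right _ _) hN2
  have e1 : (4 * K) ^ (k + 1) = 4 * (K * N) := by rw [pow_succ]; ring
  rw [e1, prob_half_eq, prob_half_eq]
  push_cast
  set M : ℕ := K * N with hM_def
  have hM : 5 * N ≤ M := Nat.mul_le_mul_right N hK5
  have hMz : ((K : ℤ) * N : ℤ) = M := by simp [hM_def]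
  -- quasi-multiplicativity, upper half (independence)
  have step1 : μ.real arm₀[4 * ((K : ℤ) * N)] ≤ μ.real arm₀[(N : ℤ)] * μ.real E₀[(N : ℤ) + 2, 4 * ((K : ℤ) * N) - 1] :=
    HalfPlaneArm.real_arm_le_mul (X := fun v : Site 2 => v 0) (Y := fun v : Site 2 => v 1)
      HalfPlaneArm.axis_X_le HalfPlaneArm.axis_Y_le HalfPlaneArm.axis_injective half (x₀ := 0) (z₀ := 0)
      (by simp) (by simp) (by positivity) (by rw [hMz]; omega)
  -- the narrower block
  have step2 : μ.real E₀[(N : ℤ) + 2, 4 * ((K : ℤ) * N) - 1] ≤ μ.real E₀[2 * (N : ℤ), 2 * ((K : ℤ) * N)] :=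
    stub_blockAnti _ _ _ _ (by omega) (by rw [hMz]; omega) (by rw [hMz]; omega)
  -- the U's
  have step3 := hUB (2 * (N : ℤ)) ((K : ℤ) * N) (2 * ((K : ℤ) * N)) (by omega)
    (by rw [hMz]; omega) le_rfl
  rw [show (2 : ℤ) * (2 * (N : ℤ)) = 4 * N by ring] at step3
  have step3' : μ.real E₀[2 * (N : ℤ), 2 * ((K : ℤ) * N)] ≤
      1 / c * μ.real (openCrossing halfPlane (rowIcc (2 * (N : ℤ)) (4 * N)) (rowIcc ((K : ℤ) * N) (2 * ((K : ℤ) * N)))) := by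
    rw [one_div, le_inv_mul_iff₀ hc]
    exact step3
  rw [show (2 : ℤ) * K * N = 2 * ((K : ℤ) * N) by ring] at hPN
  have hA : 0 ≤ μ.real arm₀[(N : ℤ)] := measureReal_nonneg
  calc μ.real arm₀[4 * ((K : ℤ) * N)]
      ≤ μ.real arm₀[(N : ℤ)] * μ.real E₀[(N : ℤ) + 2, 4 * ((K : ℤ) * N) - 1] := step1
    _ ≤ μ.real arm₀[(N : ℤ)] * μ.real E₀[2 * (N : ℤ), 2 * ((K : ℤ) * N)] := by gcongr
    _ ≤ μ.real arm₀[(N : ℤ)] * (1 / c * (2 * 𝔽 η)) := by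
        refine mul_le_mul_of_nonneg_left (step3'.trans ?_) hA
        exact mul_le_mul_of_nonneg_left hPN (by positivity)
    _ = 2 / c * 𝔽 η * μ.real arm₀[(N : ℤ)] := by ring

/-! ## Lower blocks -/

/-- **Lower geometric blocks from the collinear integer-marks Cardy law.** For every `δ > 0` there
are `Λ = 4K ≥ 2`, `b ∈ (0, 1]` with `(-1/3 - δ) log Λ ≤ log b` and `k₀` such that
`b · θ(Λ^k) ≤ θ(Λ^{k+1})` for `k ≥ k₀`. [cite: SmirnovWernerMRL2001, Thm. 3 (j = 1), §4] -/
theorem lowerBlocks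
    (hC : ∀ A B C Y : ℤ, A < B → B < C → C < Y →
      Tendsto (fun N : ℕ ↦ μ.real (openCrossing halfPlane (rowIcc (A * N) (B * N)) (rowIcc (C * N) (Y * N))))
        atTop (𝓝 (𝔽 (crossRatio ![(A : ℝ), B, C, Y])))) :
    ∀ δ : ℝ, 0 < δ → ∃ Λ : ℕ, 2 ≤ Λ ∧ ∃ b : ℝ, 0 < b ∧ b ≤ 1 ∧ (-(1 / 3 : ℝ) - δ) * Real.log Λ ≤ Real.log b ∧
      ∃ k₀ : ℕ, ∀ k : ℕ, k₀ ≤ k → b * prob half (Λ ^ k) ≤ prob half (Λ ^ (k + 1)) := by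
  intro δ hδ
  have hs2 : (0 : ℝ) < Real.sqrt 2 := by positivity
  obtain ⟨cg, hcg, mg, hglue⟩ := HalfPlaneArm.real_arm_ge_mul (X := fun v : Site 2 => v 0)
    (Y := fun v : Site 2 => v 1) HalfPlaneArm.axis_X_le HalfPlaneArm.axis_Y_le HalfPlaneArm.axis_injective
    (emb := squareLatticeEmbedding) isIsoradial_squareLatticeEmbedding_holds
    isRhombicTiling_squareLatticeEmbedding_holds (κ := Real.sqrt 2) hs2 HalfPlaneArm.axis_re
    HalfPlaneArm.axis_im half HalfPlaneArm.axis_rswLR HalfPlaneArm.axis_rswTB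
  -- choose the modulus `K`
  have hslope := stub_lowerSlope (cg / 2) (by positivity)
  have hev : ∀ᶠ K : ℕ in atTop, -(1 / 3 : ℝ) - δ <
      Real.log (cg / 2 * 𝔽 (crossRatio ![(0 : ℝ), 1, 16 * K + 1, 32 * K])) / Real.log ((4 * K : ℕ) : ℝ) :=
    hslope.eventually (eventually_gt_nhds (by linarith))
  obtain ⟨K, hKslope, hK1⟩ := (hev.and (eventually_ge_atTop 1)).exists
  set η : ℝ := crossRatio ![(0 : ℝ), 1, 16 * K + 1, 32 * K] with hη_def
  have hK1' : (1 : ℝ) ≤ K := by exact_mod_cast hK1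
  have hη : η ∈ Ioo (0 : ℝ) 1 := crossRatio_four_mem_Ioo (by norm_num) (by linarith) (by linarith)
  have hF : 0 < 𝔽 η := cardyFunction_pos_of_mem_Ioo hη
  have hlogΛ : 0 < Real.log ((4 * K : ℕ) : ℝ) :=
    Real.log_pos (by exact_mod_cast (show 1 < 4 * K by omega))
  set b₀ : ℝ := cg / 2 * 𝔽 η with hb₀_def
  have hb₀ : 0 < b₀ := by positivity
  refine ⟨4 * K, by omega, min b₀ 1, lt_min hb₀ one_pos, min_le_right _ _, ?_, ?_⟩
  · have h1 : (-(1 / 3 : ℝ) - δ) * Real.log ((4 * K : ℕ) : ℝ) < Real.log b₀ := (lt_div_iff₀ hlogΛ).1 hKslope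
    have h2 : (-(1 / 3 : ℝ) - δ) * Real.log ((4 * K : ℕ) : ℝ) ≤ 0 :=
      mul_nonpos_of_nonpos_of_nonneg (by linarith) hlogΛ.le
    rcases le_total b₀ 1 with hb | hb
    · rw [min_eq_left hb]; exact h1.le
    · rw [min_eq_right hb, Real.log_one]; exact h2
  -- the Cardy input along `n`
  have hT := hC 0 1 (16 * K + 1) (32 * K) (by norm_num) (by omega) (by omega)
  push_cast at hT
  simp only [zero_mul, one_mul] at hT
  have hevN : ∀ᶠ n : ℕ in atTop, 𝔽 η / 2 ≤
      μ.real (openCrossing halfPlane (rowIcc 0 (n : ℤ)) (rowIcc ((16 * (K : ℤ) + 1) * n) (32 * K * n))) :=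
    (hT.eventually (eventually_gt_nhds (by linarith : 𝔽 η / 2 < 𝔽 η))).mono fun n h ↦ h.le
  obtain ⟨N₀, hN₀⟩ := eventually_atTop.1 (hevN.and (eventually_ge_atTop (max mg 1)))
  refine ⟨N₀ + 1, fun k hk ↦ ?_⟩
  obtain ⟨j, rfl⟩ : ∃ j, k = j + 1 := ⟨k - 1, by omega⟩
  -- the scale `n = K Λ^j`, `Λ^(j+1) = 4n`, `Λ^(j+2) = 16Kn`
  have hjn : N₀ ≤ K * (4 * K) ^ j := by
    have h1 : j ≤ (4 * K) ^ j := le_pow_of_two_le (by omega) j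
    have h2 : (4 * K) ^ j ≤ K * (4 * K) ^ j := Nat.le_mul_of_pos_left _ (by omega)
    omega
  obtain ⟨hPn, hn⟩ := hN₀ (K * (4 * K) ^ j) hjn
  set n : ℕ := K * (4 * K) ^ j with hn_def
  have hnm : mg ≤ n := le_trans (le_max_left _ _) hn
  have hn1 : 1 ≤ n := le_trans (le_max_right _ _) hn
  have e1 : (4 * K) ^ (j + 1) = 4 * n := by rw [pow_succ]; ring
  have e2 : (4 * K) ^ (j + 1 + 1) = 16 * (K * n) := by rw [pow_succ, pow_succ]; ring
  rw [e1, e2, prob_half_eq, prob_half_eq]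
  push_cast
  set M : ℕ := K * n with hM_def
  have hM : n ≤ M := Nat.le_mul_of_pos_left _ (by omega)
  have hMz : ((K : ℤ) * n : ℤ) = M := by simp [hM_def]
  -- quasi-multiplicativity, lower half (gluing through a U, Harris–FKG)
  have key := hglue 0 0 (2 * (n : ℤ)) n (4 * n) (16 * ((K : ℤ) * n) + 1) (by simp) (by simp) (by simp)
    (by omega) (by simp only [Pi.zero_apply]; positivity) (by positivity) (by omega) (by omega)
    (by rw [hMz]; omega)
  rw [add_sub_cancel_right] at key
  -- the row-to-row crossing crosses the block
  have hLB := stub_lowerBlock 0 (n : ℤ) ((16 * (K : ℤ) + 1) * n) (32 * K * n) n (16 * ((K : ℤ) * n) + 1)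
    (by omega) le_rfl (by rw [hMz]; omega)
    (by rw [show (16 * (K : ℤ) + 1) * n = 16 * ((K : ℤ) * n) + n by ring, hMz]; omega)
  have hA : 0 ≤ cg * μ.real arm₀[4 * (n : ℤ)] := mul_nonneg hcg.le measureReal_nonneg
  calc min b₀ 1 * μ.real arm₀[4 * (n : ℤ)] ≤ b₀ * μ.real arm₀[4 * (n : ℤ)] :=
        mul_le_mul_of_nonneg_right (min_le_left _ _) measureReal_nonneg
    _ = cg * μ.real arm₀[4 * (n : ℤ)] * (𝔽 η / 2) := by rw [hb₀_def]; ring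
    _ ≤ cg * μ.real arm₀[4 * (n : ℤ)] * μ.real E₀[(n : ℤ), 16 * ((K : ℤ) * n) + 1] :=
        mul_le_mul_of_nonneg_left (hPn.trans hLB) hA
    _ ≤ μ.real arm₀[16 * ((K : ℤ) * n)] := key

/-! ## The composition and its corollaries -/

/-- **Crux 5 ⟹ crux 6** (registered stub `halfPlaneOneArmThird_of_halfPlaneMarkDensityLaw`): the
half-plane mark density law of bond-`ℤ²` implies that the half-plane one-arm exponent exists and
equals `1/3` — the crux ⟹ collinear half-plane Cardy with integer marks (`stub_integerMarks`) ⟹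
two-sided geometric blocks for the half-plane one-arm probability (`upperBlocks`, `lowerBlocks`:
quasi-multiplicativity `HalfPlaneArm.real_arm_le_mul` / `real_arm_ge_mul`, the block dictionary
`stub_blockAnti` / `stub_upperBlock` / `stub_lowerBlock`, and the `η^{1/3}` asymptotics of Cardy's
function `stub_upperSlope` / `stub_lowerSlope`) ⟹ the exponent (`stub_exponentOfBlocks`).
[cite: SmirnovWernerMRL2001, Thm. 3 (j = 1), §4] -/
theorem halfPlaneOneArmThird_of_halfPlaneMarkDensityLaw : HalfPlaneMarkDensityLaw → HalfPlaneOneArmThird := by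
  intro hlaw
  have hC := stub_integerMarks.1 hlaw
  rw [crux_iff]
  exact stub_exponentOfBlocks (fun n ↦ prob half n) (1 / 3) (by norm_num) prob_half_pos prob_half_le_one
    prob_half_antitone (upperBlocks hC) (lowerBlocks hC)

/-- **Crux 4 ⟹ crux 6**: Cardy's formula for rectilinear conformal rectangles of bond-`ℤ²`
(`RectilinearCardy`, stmt-CriticalPhenomena-5660) implies the half-plane one-arm exponent `1/3`
(`stub_fromRectilinear` then crux 5 ⟹ crux 6). [cite: SmirnovWernerMRL2001, Thm. 3 (j = 1)] -/
theorem halfPlaneOneArmThird_of_rectilinearCardy : RectilinearCardy → HalfPlaneOneArmThird :=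
  fun h ↦ halfPlaneOneArmThird_of_halfPlaneMarkDensityLaw (stub_fromRectilinear h)

/-- **The conjunct implies crux 6**: `CardyFormulaZ2 → HalfPlaneOneArmThird`, so crux 6 of the
route (an idle hypothesis of `closes`) is NECESSARY for the conjunct, like crux 5.
[cite: SmirnovWernerMRL2001, Thm. 3 (j = 1)] -/
theorem halfPlaneOneArmThird_of_cardyFormulaZ2 : _root_.CardyFormulaZ2 → HalfPlaneOneArmThird :=
  fun h ↦ halfPlaneOneArmThird_of_halfPlaneMarkDensityLaw (halfPlaneMarkDensityLaw_of_cardyFormulaZ2 h)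

/-- The same implication for the route copy `CardyTotalPositivity.HalfPlaneOneArmThird`
(stmt-CriticalPhenomena-9328 family; the two copies coincide, `crux_shared`). [folklore] -/
theorem cardyTotalPositivity_halfPlaneOneArmThird_of_halfPlaneMarkDensityLaw :
    HalfPlaneMarkDensityLaw → Theses.CardyTotalPositivity.HalfPlaneOneArmThird :=
  fun h ↦ crux_shared.1 (halfPlaneOneArmThird_of_halfPlaneMarkDensityLaw h)

end OneArm

end Summit.CriticalPhenomena.CardyFormulaZ2.Cruxes.HalfPlaneMarkDensityLaw.SketchLine
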